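import Mathlib
import Literature.Analysis.FluidPDE.HardSphereCollisionRecord
import Literature.MathematicalPhysics.KineticTheory.HardSphereEuler
import Literature.MathematicalPhysics.KineticTheory.HardSphereEulerProofs
import Summits.AtomisticToContinuum.HydrodynamicLimit.Theorems.OneFlightGossipEngineOneFlightLayeredChaosFluxRegimes
import HarnessLib

/-!
# `OneFlightGossipEngine.OneFlightLayeredChaos` — measurability of the normalised flux functional and set helpers
(crux stmt-AtomisticToContinuum-14535, line `Sketch`, serves the stub `stub_firstFlight_flux` — the `n = 0`, fresh-partner
rung — through the registered stub `measurable_fluxFn`; stub worker of lead cycle c3, 2026-08-16). Part of the Lean-checked reduction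
`FirstFlightVelInput θ₀ → FirstFlightPairInput θ₀ → FirstFlightInput θ₀ → RegimeFluxBody θ₀ ((shortGap θ₀ 0).inter nZero)`
split over the files `…FirstCollision`, `…FluxFunctional`, `…PairMeasurable`, `…FirstFlightInput`,
`…FirstFlightPairInput`, `…FirstFlightVelInput` (grouping namespace `OLC`).

`measurable_fluxFn`: `g ↦ Flux_g(S_g) = ∫_{S_g} (−⟪ω,g⟫)₊ dω / ∫ (−⟪ω,g⟫)₊ dω` is measurable for measurable `S ⊆ ℝ³ × ℝ³`
(Tonelli measurability of parametric `lintegral`s over the finite sphere measure); `fluxFn_mem_Icc`: it lies in `[0, 1]`;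
`measurableSet_inter_setOf_of_restrict`: `s ∩ {p}` is measurable when `p` is measurable on the subtype `s`;
`measurableSet_diag_preimage`: pull-back of a `𝒢`-event along the diagonal. No definitions. Downstream users:
`…PairMeasurable`, `…FirstFlightInput`, `…FirstFlightPairInput`, `…FirstFlightVelInput` (the flux functional appears verbatim in
`RegimeFluxBody`, so its measurability is what makes the compensator `∫ Flux dP` a Bochner integral there).
-/

open scoped BigOperators ENNReal
open MeasureTheory Set
open Literature.Analysis.FluidPDE Literature.MathematicalPhysics.KineticTheory
open Summit.AtomisticToContinuum.HydrodynamicLimit.Theorems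

namespace Summit.AtomisticToContinuum.HydrodynamicLimit.Theorems.OLC

noncomputable section

/-! ## Measurability helpers -/

/-- A set of the form `s ∩ {x | p x}` is measurable as soon as `s` is and `p` is measurable on the subtype `s`.
[folklore] -/
theorem measurableSet_inter_setOf_of_restrict {α : Type*} [MeasurableSpace α] {s : Set α} (hs : MeasurableSet s)
    {p : α → Prop} (hp : MeasurableSet {x : s | p x}) : MeasurableSet (s ∩ {x | p x}) := by
  have : s ∩ {x | p x} = Subtype.val '' {x : s | p x} := by
    ext x
    simp only [mem_inter_iff, mem_setOf_eq, mem_image, Subtype.exists, exists_and_right, exists_eq_right,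
      exists_prop]
  rw [this]
  exact hs.subtype_image hp

/-- **The normalised flux functional is measurable in the direction**: for measurable `S ⊆ ℝ³ × ℝ³`,
`g ↦ Flux_g(S_g) = ∫_{S_g} (−⟪ω,g⟫)₊ dω / ∫ (−⟪ω,g⟫)₊ dω` is measurable (Tonelli measurability of parametric
`lintegral`s over the finite sphere measure). [folklore] -/
theorem measurable_fluxFn : ∀ {S : Set (Literature.MathematicalPhysics.KineticTheory.V3 × Literature.MathematicalPhysics.KineticTheory.V3)}, MeasurableSet S → Measurable fun g : Literature.MathematicalPhysics.KineticTheory.V3 => ((∫⁻ ω, {ω' : Literature.MathematicalPhysics.KineticTheory.V3 | (g, ω') ∈ S}.indicator (fun _ => (1 : ENNReal)) (ω : Literature.MathematicalPhysics.KineticTheory.V3) * ENNReal.ofReal (max (-inner ℝ (ω : Literature.MathematicalPhysics.KineticTheory.V3) g) 0) ∂(Literature.MathematicalPhysics.KineticTheory.sphereMeasure (E := Literature.MathematicalPhysics.KineticTheory.V3))) / (∫⁻ ω, ENNReal.ofReal (max (-inner ℝ (ω : Literature.MathematicalPhysics.KineticTheory.V3) g) 0) ∂(Literature.MathematicalPhysics.KineticTheory.sphereMeasure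 (E := Literature.MathematicalPhysics.KineticTheory.V3)))).toReal := by
  intro S hS
  haveI : IsFiniteMeasure (sphereMeasure (E := V3)) := by unfold sphereMeasure; infer_instance
  have hk : Measurable fun p : V3 × Metric.sphere (0 : V3) 1 =>
      ENNReal.ofReal (max (-inner ℝ (p.2 : V3) p.1) 0) :=
    (((measurable_subtype_coe.comp measurable_snd).inner measurable_fst).neg.max measurable_const).ennreal_ofReal
  have hind : Measurable fun p : V3 × Metric.sphere (0 : V3) 1 =>
      S.indicator (fun _ => (1 : ℝ≥0∞)) (p.1, (p.2 : V3)) :=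
    (measurable_const.indicator hS).comp (measurable_fst.prodMk (measurable_subtype_coe.comp measurable_snd))
  have hind' : (fun p : V3 × Metric.sphere (0 : V3) 1 =>
      {ω' : V3 | (p.1, ω') ∈ S}.indicator (fun _ => (1 : ℝ≥0∞)) (p.2 : V3)) =
      fun p => S.indicator (fun _ => (1 : ℝ≥0∞)) (p.1, (p.2 : V3)) := by
    funext p
    by_cases h : (p.1, (p.2 : V3)) ∈ S
    · rw [Set.indicator_of_mem h, Set.indicator_of_mem (show (p.2 : V3) ∈ {ω' : V3 | (p.1, ω') ∈ S} from h)]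
    · rw [Set.indicator_of_notMem h,
        Set.indicator_of_notMem (show (p.2 : V3) ∉ {ω' : V3 | (p.1, ω') ∈ S} from h)]
  have hind2 : Measurable fun p : V3 × Metric.sphere (0 : V3) 1 =>
      {ω' : V3 | (p.1, ω') ∈ S}.indicator (fun _ => (1 : ℝ≥0∞)) (p.2 : V3) := by
    rw [hind']
    exact hind
  have hnum : Measurable fun g : V3 => ∫⁻ ω, {ω' : V3 | (g, ω') ∈ S}.indicator (fun _ => (1 : ℝ≥0∞)) (ω : V3) *
      ENNReal.ofReal (max (-inner ℝ (ω : V3) g) 0) ∂(sphereMeasure (E := V3)) :=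
    (hind2.mul hk).lintegral_prod_right'
  have hden : Measurable fun g : V3 => ∫⁻ ω, ENNReal.ofReal (max (-inner ℝ (ω : V3) g) 0)
      ∂(sphereMeasure (E := V3)) := hk.lintegral_prod_right'
  exact (hnum.div hden).ennreal_toReal

/-- The normalised flux functional takes values in `[0, 1]`. [folklore] -/
theorem fluxFn_mem_Icc (g : V3) (U : Set V3) :
    ((∫⁻ ω, U.indicator (fun _ => (1 : ℝ≥0∞)) (ω : V3) * ENNReal.ofReal (max (-inner ℝ (ω : V3) g) 0)
          ∂(sphereMeasure (E := V3))) /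
        (∫⁻ ω, ENNReal.ofReal (max (-inner ℝ (ω : V3) g) 0) ∂(sphereMeasure (E := V3)))).toReal ∈
      Icc (0 : ℝ) 1 := by
  refine ⟨ENNReal.toReal_nonneg, ENNReal.toReal_le_of_le_ofReal zero_le_one ?_⟩
  rw [ENNReal.ofReal_one]
  refine ENNReal.div_le_of_le_mul ?_
  rw [one_mul]
  refine lintegral_mono fun ω => ?_
  have hle : U.indicator (fun _ => (1 : ℝ≥0∞)) (ω : V3) ≤ 1 :=
    Set.indicator_apply_le' (fun _ => le_rfl) (fun _ => zero_le_one)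
  exact mul_le_of_le_one_left' hle

/-- Pulling a `𝒢`-event back along the diagonal: `{p | ((p.1, p.1), p.2) ∈ T}` is measurable for measurable `T`.
[folklore] -/
theorem measurableSet_diag_preimage {α β : Type*} [MeasurableSpace α] [MeasurableSpace β]
    {T : Set ((α × α) × β)} (hT : MeasurableSet T) :
    MeasurableSet {p : α × β | ((p.1, p.1), p.2) ∈ T} :=
  ((measurable_fst.prodMk measurable_fst).prodMk measurable_snd) hT

end

end Summit.AtomisticToContinuum.HydrodynamicLimit.Theorems.OLC
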